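import Literature.AlgebraicGeometry.AbelianSchemes.AbelianSchemeOverRingAction
import Literature.AlgebraicGeometry.AbelianSchemes.AbelianSchemePolarization
import Literature.AlgebraicGeometry.AbelianSchemes.AbelianSchemeOverLevelBaseChange
import Literature.AlgebraicGeometry.AbelianSchemes.AbelianSchemePolarizationBaseChange
import Literature.AlgebraicGeometry.AbelianSchemes.TupleIsoAtOfFibreIso
import Literature.AlgebraicGeometry.Morphisms.HomSchemePieceOfLayersFiniteType
import Literature.AlgebraicGeometry.Morphisms.ProjectiveSpaceSegreVeronese
import Literature.AlgebraicGeometry.Morphisms.SegreProductEmbedding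
import Literature.AlgebraicGeometry.Morphisms.HomSchemePiecePoints
import Literature.AlgebraicGeometry.AbelianSchemes.TupleIsoPointCriteria
import HarnessLib

/-!
# Letters of a tuple-isomorphism force admissibility (the EMPTY `Isom`-piece of a non-admissible pair) — (O-D) part 1

Topic `Literature/AlgebraicGeometry/AbelianSchemes`; namespace `Literature.AlgebraicGeometry.AbelianSchemes.AbelianSchemeOver`.  THEOREMS ONLY
(no definition, no named fact, no instance, no notation, no `sorry`).  Cell `hodgecm-mathlib` (D-0151), P6 «MOD programme» (crux hLiu418 =
stmt-HodgeConjecture-24832), LINE `Cruxes/HLiu418/Lines/F0_P6a_IsomSchemeFiniteType.lean` ED. 1 (87c7f255f54f) `stub_ICON` :187, closer (O-D) part 1 (A-p14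
(g34)): the `by_cases` branch «`Q` or `Q′` not admissible ⇒ the left side of the `stub_ICON` iff is FALSE at every geometric point», so the
piece may be taken `∅`.  Inputs ★ `Morphisms/HomSchemePiecePoints.floor_eval_eq_of_graphLetters` (p847222), ★ `Morphisms/SegreProductEmbedding`
(p847206), ★ `AbelianSchemes/TupleIsoPointCriteria.isIso_of_isBaseChangeVia_id` (p847224, A-p13 (g37)).  HC_CM is proved only modulo the 2 remaining
named inputs (hLiu418, h413) until rung 0 closes; generic, count-neutral.

## References
* [MumfordFogartyKirwan1994] D. Mumford, J. Fogarty, F. Kirwan, *Geometric Invariant Theory*, 3rd ed. (1994), Ch. 0 §5 (c) (p. 23); Ch. 7 §2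
  Definition 7.2 (p. 129), Prop. 7.3 (p. 132).
* [Hartshorne1977] R. Hartshorne, *Algebraic Geometry* (1977), III Thm. 9.9 (p. 261).
-/

set_option autoImplicit false

noncomputable section

set_option backward.isDefEq.respectTransparency false

open CategoryTheory CategoryTheory.Limits CategoryTheory.Abelian AlgebraicGeometry Polynomial MonoidalCategory
open Literature.AlgebraicGeometry Literature.AlgebraicGeometry.Morphisms
open Literature.AlgebraicGeometry.Modules Literature.AlgebraicGeometry.Modules.SerreTwist
open Literature.Algebra.Homology Literature.Algebra.Homology.LaurentCech Literature.Algebra.Homology.OrderedCech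
open Literature.AlgebraicGeometry.AbelianSchemes Literature.AlgebraicGeometry.AbelianVarieties

namespace Literature.AlgebraicGeometry.AbelianSchemes

namespace AbelianSchemeOver

/-- **Letters of a tuple-isomorphism force ADMISSIBILITY of both polynomials.**  If at a geometric point `t` some tuple-isomorphism
`(G, Ĝ)` has graph letters `Q` (through the product embedding `prodEmb j₁ j₂`) and its inverses have graph letters `Q′` (through
`prodEmb j₂ j₁`), then `⌊Q(e)⌋₊ = Q(e)` and `⌊Q′(e)⌋₊ = Q′(e)` beyond Mumford's thresholds — the hypothesis ★
`Morphisms.exists_homSchemePiece_of_layers_quasiCompact` asks of its polynomial; contrapositively the `Isom`-piece of a NON-admissible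
pair is EMPTY.  (★ `Morphisms.floor_eval_eq_of_graphLetters` at the field point `𝟙 (Spec Ω)`; `G` is an isomorphism by ★
`isIso_of_isBaseChangeVia_id`, so `G⁻¹` is the inverse the second clause speaks about; the hypothesis is the LEFT side of the cell's
`stub_ICON` iff VERBATIM, `TupleIsoVia`∕`GraphLetters`∕`prodEmb` unfolded.)
[cite: MumfordFogartyKirwan1994, Ch. 0 §5 (c) (p. 23) and Ch. 7 §2 Definition 7.2 (p. 129)] [cite: Hartshorne1977, III Thm. 9.9 (p. 261)] -/
theorem floor_eval_eq_of_exists_tupleIso_letters {O : Type} [CommRing O] {Y : Scheme.{0}} [IsNoetherian Y]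
    (𝒜₁ : AbelianSchemeOver Y) (ρ₁ : 𝒜₁.RingAction O) (D₁ : 𝒜₁.DualPair) (pol₁ : 𝒜₁.Polarization D₁)
    {g N : ℕ} (lvl₁ : 𝒜₁.LevelStructure g N)
    (𝒜₂ : AbelianSchemeOver Y) (ρ₂ : 𝒜₂.RingAction O) (D₂ : 𝒜₂.DualPair) (pol₂ : 𝒜₂.Polarization D₂)
    (lvl₂ : 𝒜₂.LevelStructure g N) {n : ℕ}
    (j₁ : 𝒜₁.X.left ⟶ Morphisms.projectiveSpace (Fin n) Y) (hj₁ : j₁ ≫ Morphisms.projectiveSpaceFst (Fin n) Y = 𝒜₁.X.hom)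
    (j₂ : 𝒜₂.X.left ⟶ Morphisms.projectiveSpace (Fin n) Y) (hj₂ : j₂ ≫ Morphisms.projectiveSpaceFst (Fin n) Y = 𝒜₂.X.hom)
    (Q Q' : ℚ[X])
    ⦃Ω : Type⦄ [Field Ω] [IsAlgClosed Ω] (t : Spec (CommRingCat.of Ω) ⟶ Y)
    (h : (∃ (G : (𝒜₁.baseChange t).X.left ⟶ (𝒜₂.baseChange t).X.left)
          (Ĝ : (D₁.baseChange t).hat.X.left ⟶ (D₂.baseChange t).hat.X.left),
          ((lvl₁.baseChange t).IsBaseChangeVia (lvl₂.baseChange t) (𝟙 _) G ∧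
            (D₁.baseChange t).hat.IsBaseChangeVia (D₂.baseChange t).hat (𝟙 _) Ĝ ∧
            (∃ (wG : (𝒜₁.baseChange t).X.hom ≫ 𝟙 _ = G ≫ (𝒜₂.baseChange t).X.hom)
                (wĜ : (D₁.baseChange t).hat.X.hom ≫ 𝟙 _ = Ĝ ≫ (D₂.baseChange t).hat.X.hom),
              Nonempty ((Scheme.Modules.pullback
                  (pullback.map (𝒜₁.baseChange t).X.hom (D₁.baseChange t).hat.X.hom
                    (𝒜₂.baseChange t).X.hom (D₂.baseChange t).hat.X.hom G Ĝ (𝟙 _) wG wĜ)).obj (D₂.baseChange t).P ≅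
                (D₁.baseChange t).P)) ∧
            (pol₁.baseChange t).lam.left ≫ Ĝ = G ≫ (pol₂.baseChange t).lam.left ∧
            ∀ a : O, (AbelianSchemeOver.baseChangeHom (ρ₁.i a) t).left ≫ G =
              G ≫ (AbelianSchemeOver.baseChangeHom (ρ₂.i a) t).left) ∧
          (∀ (hw : pullback.fst 𝒜₁.X.hom t ≫ 𝒜₁.X.hom = (G ≫ pullback.fst 𝒜₂.X.hom t) ≫ 𝒜₂.X.hom)
              (iΓ : pullback 𝒜₁.X.hom t ⟶ Morphisms.projectiveSpace (Fin (n * n + n + n)) (Spec (CommRingCat.of Ω))),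
              iΓ ≫ Morphisms.projectiveSpaceFst (Fin (n * n + n + n)) (Spec (CommRingCat.of Ω)) = pullback.snd 𝒜₁.X.hom t →
              iΓ ≫ Morphisms.projectiveSpaceMap (Fin (n * n + n + n)) t =
                pullback.lift (pullback.fst 𝒜₁.X.hom t) (G ≫ pullback.fst 𝒜₂.X.hom t) hw ≫
                  (MonoidalCategoryStruct.tensorHom
                (Over.homMk j₁ hj₁ : 𝒜₁.X ⟶ Over.mk (Morphisms.projectiveSpaceFst (Fin n) Y))
                (Over.homMk j₂ hj₂ : 𝒜₂.X ⟶ Over.mk (Morphisms.projectiveSpaceFst (Fin n) Y)) ≫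
              Morphisms.segreOver Y (Morphisms.segreIndexEquivFin n n)).left →
              ∀ ⦃K : Type⦄ [Field K] ⦃X' : Scheme.{0}⦄ (k : X' ⟶ pullback 𝒜₁.X.hom t) (f₀ : X' ⟶ Spec (CommRingCat.of K))
                (x : Spec (CommRingCat.of K) ⟶ (Spec (CommRingCat.of Ω))),
                IsPullback k f₀ (iΓ ≫ Morphisms.projectiveSpaceFst (Fin (n * n + n + n)) (Spec (CommRingCat.of Ω))) x →
                ∀ e : ℕ, regularityBound (preHilbertPoly ℚ (Nat.card (Fin (n * n + n + n))) 0) 0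
                    (preHilbertPoly ℚ (Nat.card (Fin (n * n + n + n))) 0 - Q) - 1 ≤ (e : ℤ) →
                  Subsingleton (CategoryTheory.Abelian.Ext.{1} (unitModule X') ((Scheme.Modules.pullback k).obj
                    (twistMod (iΓ ≫ pullback.snd (terminal.from (Spec (CommRingCat.of Ω))) (terminal.from (Morphisms.projectiveSpaceInt (Fin (n * n + n + n)))))
                      (unitModule _) e)) 1) ∧
                  ((Module.finrank Γ(Spec (CommRingCat.of K), ⊤) (SecMod ((Scheme.Modules.pullback k).obj
                    (twistMod (iΓ ≫ pullback.snd (terminal.from (Spec (CommRingCat.of Ω))) (terminal.from (Morphisms.projectiveSpaceInt (Fin (n * n + n + n)))))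
                      (unitModule _) e)) f₀.appTop.hom ⊤) : ℕ) : ℚ) = (Q).eval (e : ℚ)) ∧
          ∀ Ginv : (𝒜₂.baseChange t).X.left ⟶ (𝒜₁.baseChange t).X.left, Ginv ≫ G = 𝟙 _ → G ≫ Ginv = 𝟙 _ →
            (∀ (hw : pullback.fst 𝒜₂.X.hom t ≫ 𝒜₂.X.hom = (Ginv ≫ pullback.fst 𝒜₁.X.hom t) ≫ 𝒜₁.X.hom)
              (iΓ : pullback 𝒜₂.X.hom t ⟶ Morphisms.projectiveSpace (Fin (n * n + n + n)) (Spec (CommRingCat.of Ω))),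
              iΓ ≫ Morphisms.projectiveSpaceFst (Fin (n * n + n + n)) (Spec (CommRingCat.of Ω)) = pullback.snd 𝒜₂.X.hom t →
              iΓ ≫ Morphisms.projectiveSpaceMap (Fin (n * n + n + n)) t =
                pullback.lift (pullback.fst 𝒜₂.X.hom t) (Ginv ≫ pullback.fst 𝒜₁.X.hom t) hw ≫
                  (MonoidalCategoryStruct.tensorHom
                (Over.homMk j₂ hj₂ : 𝒜₂.X ⟶ Over.mk (Morphisms.projectiveSpaceFst (Fin n) Y))
                (Over.homMk j₁ hj₁ : 𝒜₁.X ⟶ Over.mk (Morphisms.projectiveSpaceFst (Fin n) Y)) ≫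
              Morphisms.segreOver Y (Morphisms.segreIndexEquivFin n n)).left →
              ∀ ⦃K : Type⦄ [Field K] ⦃X' : Scheme.{0}⦄ (k : X' ⟶ pullback 𝒜₂.X.hom t) (f₀ : X' ⟶ Spec (CommRingCat.of K))
                (x : Spec (CommRingCat.of K) ⟶ (Spec (CommRingCat.of Ω))),
                IsPullback k f₀ (iΓ ≫ Morphisms.projectiveSpaceFst (Fin (n * n + n + n)) (Spec (CommRingCat.of Ω))) x →
                ∀ e : ℕ, regularityBound (preHilbertPoly ℚ (Nat.card (Fin (n * n + n + n))) 0) 0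
                    (preHilbertPoly ℚ (Nat.card (Fin (n * n + n + n))) 0 - Q') - 1 ≤ (e : ℤ) →
                  Subsingleton (CategoryTheory.Abelian.Ext.{1} (unitModule X') ((Scheme.Modules.pullback k).obj
                    (twistMod (iΓ ≫ pullback.snd (terminal.from (Spec (CommRingCat.of Ω))) (terminal.from (Morphisms.projectiveSpaceInt (Fin (n * n + n + n)))))
                      (unitModule _) e)) 1) ∧
                  ((Module.finrank Γ(Spec (CommRingCat.of K), ⊤) (SecMod ((Scheme.Modules.pullback k).obj
                    (twistMod (iΓ ≫ pullback.snd (terminal.from (Spec (CommRingCat.of Ω))) (terminal.from (Morphisms.projectiveSpaceInt (Fin (n * n + n + n)))))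
                      (unitModule _) e)) f₀.appTop.hom ⊤) : ℕ) : ℚ) = (Q').eval (e : ℚ)))) :
    (∀ e : ℕ, regularityBound (preHilbertPoly ℚ (Nat.card (Fin (n * n + n + n))) 0) 0
        (preHilbertPoly ℚ (Nat.card (Fin (n * n + n + n))) 0 - Q) - 1 ≤ (e : ℤ) → ((⌊Q.eval (e : ℚ)⌋₊ : ℕ) : ℚ) = Q.eval (e : ℚ)) ∧
    (∀ e : ℕ, regularityBound (preHilbertPoly ℚ (Nat.card (Fin (n * n + n + n))) 0) 0
        (preHilbertPoly ℚ (Nat.card (Fin (n * n + n + n))) 0 - Q') - 1 ≤ (e : ℤ) → ((⌊Q'.eval (e : ℚ)⌋₊ : ℕ) : ℚ) = Q'.eval (e : ℚ)) := by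
  obtain ⟨G, Ĝ, hvia, hQ, hQ'⟩ := h
  obtain ⟨⟨hX, -⟩, -, ⟨wG, -, -⟩, -, -⟩ := hvia
  have hφ : G ≫ pullback.snd 𝒜₂.X.hom t = pullback.snd 𝒜₁.X.hom t := by
    have w := wG
    change pullback.snd 𝒜₁.X.hom t ≫ 𝟙 _ = G ≫ pullback.snd 𝒜₂.X.hom t at w
    rw [Category.comp_id] at w
    exact w.symm
  have hjW₁₂ := Morphisms.prodEmb_comp_projectiveSpaceFst 𝒜₁.X 𝒜₂.X j₁ hj₁ j₂ hj₂
  have hjW₂₁ := Morphisms.prodEmb_comp_projectiveSpaceFst 𝒜₂.X 𝒜₁.X j₂ hj₂ j₁ hj₁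
  refine ⟨Morphisms.floor_eval_eq_of_graphLetters 𝒜₁.X.hom 𝒜₂.X.hom _ hjW₁₂ t G hφ Q hQ (𝟙 _), ?_⟩
  haveI : IsIso G := isIso_of_isBaseChangeVia_id hX
  have hφ' : inv G ≫ pullback.snd 𝒜₁.X.hom t = pullback.snd 𝒜₂.X.hom t := by
    rw [IsIso.inv_comp_eq, hφ]
  exact Morphisms.floor_eval_eq_of_graphLetters 𝒜₂.X.hom 𝒜₁.X.hom _ hjW₂₁ t (inv G) hφ' Q'
    (hQ' (inv G) (IsIso.inv_hom_id G) (IsIso.hom_inv_id G)) (𝟙 _)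

end AbelianSchemeOver

end Literature.AlgebraicGeometry.AbelianSchemes

end
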